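import Summits.RiemannHypothesis.RiemannHypothesis.Theorems.JensenPolynomialsFarGumbelModeCM

/-!
# Route `JensenPolynomials`, FAR crux `XiWindowZeroFreeRelFar` (B1-rel far) — line «far-gumbel» (theory g8, v5),
stub S2 `stub_junk`, part D: the NUMERICAL BUDGET (RH-FREE; cell rh-jensen, HUMAN RULING D-0040; helper for item
`stmt-RiemannHypothesis-19465`)

Pure real-variable inequalities. With the far mode `υ` (`4πe^{4υ}υ = 2M + 9υ`, `υ ≥ 189/20`), `Λ = πe^{4υ} = M/(2υ) + 9/4`,
`m = M/υ`, `S = e^{9υ}υ^{2M}q^{M−½}` (`q = ‖1 + z̃‖ ≥ 0.6498`) and `A = ‖a‖ ≤ 0.3502υ²`, the six region terms of parts B/B2/C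

  `T₁ = 0.45(0.5102υ²)^M(υ−2)`, `T₂ = 50·S·ρ^{M−½}(υ−2)` (`ρ = ((υ−2)²/υ² + 0.3502)/1.3502`),
  `T₃ = 0.225A^{M+1}(2υ/5)^{−2}(υ−2)`, `T₄ = 0.71A^M A^{3/4}(2υ/5)^{−1}·4√(υ−2)`,
  `T₅ = (0.5635^{M+1}/2)(50 + e^{18})·S·e²`, `T₆ = 1.65A^{M+1}(υ−2)^{−1}`

are each `≤ 5·S·e^{−11m/16}` and `(π²/2)e^{−9Λ/8}√(2π/Λ) ≥ 30e^{−11m/16}`, so `∑ Tᵢ ≤ farEnv` (`junk_budget`, `farEnv_eq`);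
also `‖farA M s‖ ≤ 0.3502υ²` for `‖s‖ ≤ (7/20)M` (`norm_farA_le`). WHAT THIS IS NOT: elementary real inequalities; nothing
here bears on the zeros of `ζ` or the truth of RH. References: [GORZPNAS2019]; theory g8's card `far-gumbel` v5.
-/

noncomputable section
-- D-0017: `Summit.RiemannHypothesis.RiemannHypothesis.…` duplicates the namespace BY DESIGN (single-problem summit).
set_option linter.dupNamespace false

namespace Summit.RiemannHypothesis.RiemannHypothesis.Theorems.JensenPolynomials.FarGumbel

open Real

/-! ## 1. Mode facts and the envelope -/

/-- From the mode equation (`e^{4υ} ≥ 1 + 4υ`, `π > 3`): `24υ² ≤ M`. -/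
theorem mode_sq_le (M : ℕ) {υ : ℝ}
    (hυ : (189 / 20 : ℝ) ≤ υ ∧ 4 * π * exp (4 * υ) * υ = 2 * (M : ℝ) + 9 * υ) :
    24 * υ ^ 2 ≤ (M : ℝ) := by
  have hυ0 : 0 < υ := by linarith [hυ.1]
  have h1 : 1 + 4 * υ ≤ exp (4 * υ) := by linarith [add_one_le_exp (4 * υ)]
  have h2 : 3 * ((1 + 4 * υ) * υ) ≤ π * (exp (4 * υ) * υ) :=
    mul_le_mul pi_gt_three.le (mul_le_mul_of_nonneg_right h1 hυ0.le) (by positivity) pi_pos.le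
  nlinarith [h2, hυ.2, hυ.1]

/-- `farEnv = (π²/2)·e^{9υ}υ^{2M}·‖1+z‖^{M−½}·(e^{−9Λ/8}·√(2π/Λ))`, `Λ = πe^{4υ}`. -/
theorem farEnv_eq (M : ℕ) {υ : ℝ} (hυ : 0 < υ) (z : ℂ) :
    farEnv M υ z = π ^ 2 / 2 * exp (9 * υ) * υ ^ (2 * M) * ‖1 + z‖ ^ ((M : ℝ) - 1 / 2) *
      (exp (-(9 / 8) * farLam υ) * Real.sqrt (2 * π / farLam υ)) := by
  have hΛ : 0 < farLam υ := by unfold farLam; positivity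
  have hP : 0 < π ^ 2 / 2 * exp (9 * υ) * υ ^ (2 * M) := by positivity
  have hy : 0 < 2 * π / farLam υ := by positivity
  have hs : Real.sqrt (2 * π / farLam υ) = exp (1 / 2 * Real.log (2 * π / farLam υ)) := by
    rw [Real.sqrt_eq_rpow, Real.rpow_def_of_pos hy]; ring_nf
  have h98 : exp (-(9 / 8) * farLam υ) = exp (-farLam υ / 8) / exp (farLam υ) := by
    rw [← Real.exp_sub]; congr 1; ring
  rw [hs, h98]
  unfold farEnv farL0
  rw [Real.exp_add, Real.exp_sub, Real.exp_log hP]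
  have hE : exp (farLam υ) ≠ 0 := (exp_pos _).ne'
  field_simp

/-- **Envelope factor.** At the far mode: `30·e^{−(11/16)(M/υ)} ≤ (π²/2)·e^{−9Λ/8}·√(2π/Λ)` (`Λ = πe^{4υ} = M/(2υ)+9/4`,
so `(11/16)(M/υ) = (11/8)Λ − 99/32`; `√(2π/Λ) ≥ 2π/Λ ≥ 6/Λ`, `e^{Λ/4} ≥ Λ³/384`, `Λ ≥ 2000`, `e^{99/32} ≤ e⁴ ≤ 55`). -/
theorem farEnv_factor_lower (M : ℕ) {υ : ℝ}
    (hυ : (189 / 20 : ℝ) ≤ υ ∧ 4 * π * exp (4 * υ) * υ = 2 * (M : ℝ) + 9 * υ) :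
    30 * exp (-(11 / 16) * ((M : ℝ) / υ)) ≤
      π ^ 2 / 2 * (exp (-(9 / 8) * farLam υ) * Real.sqrt (2 * π / farLam υ)) := by
  have hυ0 : 0 < υ := by linarith [hυ.1]
  -- `Λ ≥ 2000`
  have hΛge : 2000 ≤ farLam υ := by
    unfold farLam
    have h1 : 1 + 4 * υ + (4 * υ) ^ 2 / 2 ≤ exp (4 * υ) := quadratic_le_exp_of_nonneg (by linarith [hυ.1])
    have h2 : (700 : ℝ) ≤ exp (4 * υ) := by nlinarith [hυ.1]
    nlinarith [pi_gt_three]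
  -- `Λ = M/(2υ) + 9/4`, i.e. `M/υ = 2Λ − 9/2`
  have hm : (M : ℝ) / υ = 2 * farLam υ - 9 / 2 := by
    unfold farLam
    rw [div_eq_iff hυ0.ne']
    linarith [hυ.2]
  set Λ : ℝ := farLam υ with hΛdef
  have hΛ0 : 0 < Λ := by linarith
  -- `√(2π/Λ) ≥ 2π/Λ ≥ 6/Λ`
  have hx1 : 2 * π / Λ ≤ 1 := by rw [div_le_one hΛ0]; linarith [pi_lt_four]
  have hx0 : 0 ≤ 2 * π / Λ := by positivity
  have hsqrt : 2 * π / Λ ≤ Real.sqrt (2 * π / Λ) := Real.le_sqrt_of_sq_le (by nlinarith)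
  have h6 : 6 / Λ ≤ 2 * π / Λ := div_le_div_of_nonneg_right (by linarith [pi_gt_three]) hΛ0.le
  have hs : 6 / Λ ≤ Real.sqrt (2 * π / Λ) := h6.trans hsqrt
  -- `e^{Λ/4} ≥ Λ³/384`
  have hE : Λ ^ 3 / 384 ≤ exp (Λ / 4) := by
    have h := pow_div_factorial_le_exp (Λ / 4) (by positivity) 3
    have h' : (Λ / 4) ^ 3 / (Nat.factorial 3 : ℝ) = Λ ^ 3 / 384 := by norm_num [Nat.factorial]; ring
    linarith [h' ▸ h]
  -- `e^{99/32} ≤ 55`, `π²/2 ≥ 4.9`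
  have he4 : exp (99 / 32) ≤ 55 := by
    have h1 : exp (99 / 32) ≤ exp 4 := exp_le_exp.mpr (by norm_num)
    have h2 : exp 4 = exp 1 ^ 4 := by rw [← Real.exp_nat_mul]; norm_num
    have h3 : exp 1 ≤ 2.72 := (lt_trans exp_one_lt_d9 (by norm_num)).le
    have h4 : exp 1 ^ 4 ≤ 2.72 ^ 4 := pow_le_pow_left₀ (exp_pos 1).le h3 4
    have h5 : (2.72 : ℝ) ^ 4 ≤ 55 := by norm_num
    linarith [h2 ▸ h4]
  have hpi : 4.9 ≤ π ^ 2 / 2 := by nlinarith [pi_gt_d2]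
  -- rewrite both exponentials through `X = e^{−11Λ/8}`
  have hX : exp (-(11 / 16) * ((M : ℝ) / υ)) = exp (-(11 / 8) * Λ) * exp (99 / 32) := by
    rw [← Real.exp_add]; congr 1; rw [hm]; ring
  have hP : exp (-(9 / 8) * Λ) = exp (-(11 / 8) * Λ) * exp (Λ / 4) := by
    rw [← Real.exp_add]; congr 1; ring
  have key : 30 * exp (99 / 32) ≤ π ^ 2 / 2 * (exp (Λ / 4) * Real.sqrt (2 * π / Λ)) := by
    have h1 : Λ ^ 3 / 384 * (6 / Λ) ≤ exp (Λ / 4) * Real.sqrt (2 * π / Λ) :=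
      mul_le_mul hE hs (by positivity) (exp_pos _).le
    have heq : Λ ^ 3 / 384 * (6 / Λ) = Λ ^ 2 / 64 := by field_simp; ring
    rw [heq] at h1
    have h2 : (62500 : ℝ) ≤ Λ ^ 2 / 64 := by nlinarith
    nlinarith [he4, hpi, h1, h2, (exp_pos (99 / 32)).le]
  rw [hX, hP]
  calc 30 * (exp (-(11 / 8) * Λ) * exp (99 / 32)) = exp (-(11 / 8) * Λ) * (30 * exp (99 / 32)) := by ring
    _ ≤ exp (-(11 / 8) * Λ) * (π ^ 2 / 2 * (exp (Λ / 4) * Real.sqrt (2 * π / Λ))) :=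
        mul_le_mul_of_nonneg_left key (exp_pos _).le
    _ = π ^ 2 / 2 * (exp (-(11 / 8) * Λ) * exp (Λ / 4) * Real.sqrt (2 * π / Λ)) := by ring

/-- `e^{−(11/16)(M/υ)} ≥ 0.927^M` for `υ ≥ 189/20` (`11/(16υ) ≤ 0.073`, `e^{−0.073} ≥ 0.927`). -/
theorem exp_scale_lower (M : ℕ) {υ : ℝ} (hυ : (189 / 20 : ℝ) ≤ υ) :
    (0.927 : ℝ) ^ M ≤ exp (-(11 / 16) * ((M : ℝ) / υ)) := by
  have hυ0 : 0 < υ := by linarith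
  have h4 : (0.927 : ℝ) ≤ exp (-(0.073 : ℝ)) := by linarith [one_sub_le_exp_neg (0.073 : ℝ)]
  have h5 : (0.927 : ℝ) ^ M ≤ exp (-(0.073 : ℝ)) ^ M := pow_le_pow_left₀ (by norm_num) h4 M
  refine h5.trans ?_
  rw [← Real.exp_nat_mul]
  apply exp_le_exp.mpr
  rw [show -(11 / 16) * ((M : ℝ) / υ) = (M : ℝ) * (-(11 / 16 / υ)) by ring]
  apply mul_le_mul_of_nonneg_left _ (Nat.cast_nonneg M)
  rw [neg_le_neg_iff, div_le_iff₀ hυ0]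
  nlinarith

/-- **Scale.** `e^{9υ}υ^{2M}·0.6023^M ≤ S·e^{−(11/16)(M/υ)}` with `S = e^{9υ}υ^{2M}q^{M−½}`, `q ≥ 0.6498`, `M ≥ 1`. -/
theorem junk_scale_lower {M : ℕ} (hM : 1 ≤ M) {υ q : ℝ} (hυ : (189 / 20 : ℝ) ≤ υ) (hq : 0.6498 ≤ q) :
    exp (9 * υ) * υ ^ (2 * M) * 0.6023 ^ M ≤
      exp (9 * υ) * υ ^ (2 * M) * q ^ ((M : ℝ) - 1 / 2) * exp (-(11 / 16) * ((M : ℝ) / υ)) := by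
  have hυ0 : 0 < υ := by linarith
  have hN0 : 0 ≤ (M : ℝ) - 1 / 2 := by
    have : (1 : ℝ) ≤ M := by exact_mod_cast hM
    linarith
  have hNM : (M : ℝ) - 1 / 2 ≤ M := by linarith
  have h1 : (0.6498 : ℝ) ^ ((M : ℝ) - 1 / 2) ≤ q ^ ((M : ℝ) - 1 / 2) := rpow_le_rpow (by norm_num) hq hN0
  have h2 : (0.6498 : ℝ) ^ ((M : ℝ)) ≤ 0.6498 ^ ((M : ℝ) - 1 / 2) :=
    rpow_le_rpow_of_exponent_ge (by norm_num) (by norm_num) hNM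
  rw [rpow_natCast] at h2
  have h3 := exp_scale_lower M hυ
  have h6 : (0.6023 : ℝ) ^ M ≤ 0.6498 ^ M * 0.927 ^ M := by
    rw [← mul_pow]; exact pow_le_pow_left₀ (by norm_num) (by norm_num) M
  have hA : 0 ≤ exp (9 * υ) * υ ^ (2 * M) := by positivity
  have h06 : (0 : ℝ) ≤ 0.6498 ^ ((M : ℝ) - 1 / 2) := by positivity
  calc exp (9 * υ) * υ ^ (2 * M) * 0.6023 ^ M ≤ exp (9 * υ) * υ ^ (2 * M) * (0.6498 ^ M * 0.927 ^ M) :=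
        mul_le_mul_of_nonneg_left h6 hA
    _ ≤ exp (9 * υ) * υ ^ (2 * M) * (q ^ ((M : ℝ) - 1 / 2) * exp (-(11 / 16) * ((M : ℝ) / υ))) := by
        apply mul_le_mul_of_nonneg_left _ hA
        exact mul_le_mul (h2.trans h1) h3 (by positivity) (h06.trans h1)
    _ = _ := by ring

/-! ## 2. The six terms -/

/-- `υ − 2 ≤ e^{9υ}`. -/
theorem sub_two_le_exp_nine {υ : ℝ} (hυ : 0 ≤ υ) : υ - 2 ≤ exp (9 * υ) := by
  linarith [add_one_le_exp (9 * υ)]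

/-- **T₁** (region R1): `0.45(0.5102υ²)^M(υ−2) ≤ 5·e^{9υ}υ^{2M}0.6023^M`. -/
theorem junk_T1_le (M : ℕ) {υ : ℝ} (hυ : (189 / 20 : ℝ) ≤ υ) :
    0.45 * (0.5102 * υ ^ 2) ^ M * (υ - 2) ≤ 5 * (exp (9 * υ) * υ ^ (2 * M) * 0.6023 ^ M) := by
  have h1 : ((0.5102 : ℝ) * υ ^ 2) ^ M = 0.5102 ^ M * υ ^ (2 * M) := by rw [mul_pow, pow_mul]
  have h2 : (0.5102 : ℝ) ^ M ≤ 0.6023 ^ M := pow_le_pow_left₀ (by norm_num) (by norm_num) M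
  have h3 : υ - 2 ≤ exp (9 * υ) := sub_two_le_exp_nine (by linarith)
  have h4 : (0.5102 : ℝ) ^ M * (υ - 2) ≤ 0.6023 ^ M * exp (9 * υ) := mul_le_mul h2 h3 (by linarith) (by positivity)
  have hP : 0 ≤ υ ^ (2 * M) := by positivity
  have h5 := mul_le_mul_of_nonneg_left h4 hP
  have h6 : 0 ≤ υ ^ (2 * M) * (0.6023 ^ M * exp (9 * υ)) := by positivity
  rw [h1]
  nlinarith [h5, h6]

/-- **T₂** (region R2, bulk): `50·S·ρ^{M−½}(υ−2) ≤ 5·S·e^{−(11/16)(M/υ)}` at the far mode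
(`ρ = 1 − 4(υ−1)/(1.3502υ²) ≤ e^{−x}`, `x(M−½) ≥ (27/16)M/υ`, `10(υ−2) ≤ e^{M/υ}` as `M ≥ 24υ²`). -/
theorem junk_T2_le (M : ℕ) (hM : 1 ≤ M) {υ : ℝ}
    (hυ : (189 / 20 : ℝ) ≤ υ ∧ 4 * π * exp (4 * υ) * υ = 2 * (M : ℝ) + 9 * υ) {q : ℝ} (hq : 0 ≤ q) :
    50 * exp (9 * υ) * υ ^ (2 * M) * q ^ ((M : ℝ) - 1 / 2) *
          (((υ - 2) ^ 2 / υ ^ 2 + 0.3502) / 1.3502) ^ ((M : ℝ) - 1 / 2) * (υ - 2) ≤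
      5 * (exp (9 * υ) * υ ^ (2 * M) * q ^ ((M : ℝ) - 1 / 2)) * exp (-(11 / 16) * ((M : ℝ) / υ)) := by
  have hυ0 : 0 < υ := by linarith [hυ.1]
  have hυ2 : 0 < υ ^ 2 := by positivity
  have hMsq := mode_sq_le M hυ
  have hN0 : 0 ≤ (M : ℝ) - 1 / 2 := by
    have : (1 : ℝ) ≤ M := by exact_mod_cast hM
    linarith
  set m : ℝ := (M : ℝ) / υ with hmdef
  have hMm : (M : ℝ) = m * υ := by rw [hmdef]; field_simp
  have hυm : 24 * υ ≤ m := by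
    rw [hmdef, le_div_iff₀ hυ0]; nlinarith [hMsq]
  have hm0 : 0 ≤ m := by nlinarith [hυ.1]
  set ρ : ℝ := ((υ - 2) ^ 2 / υ ^ 2 + 0.3502) / 1.3502 with hρdef
  set x : ℝ := 4 * (υ - 1) / (1.3502 * υ ^ 2) with hxdef
  have hρ_eq : ρ = 1 - x := by rw [hρdef, hxdef]; field_simp; ring
  have hρ0 : 0 ≤ ρ := by rw [hρdef]; positivity
  have hρle : ρ ≤ exp (-x) := by rw [hρ_eq]; exact one_sub_le_exp_neg x
  set N : ℝ := (M : ℝ) - 1 / 2 with hNdef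
  have hρN : ρ ^ N ≤ exp (-x) ^ N := rpow_le_rpow hρ0 hρle hN0
  have hexpN : exp (-x) ^ N = exp (-x * N) := by rw [← Real.exp_mul]
  -- the exponent comparison `x·N ≥ (27/16)·m`
  have hkey : 27 / 16 * m ≤ x * N := by
    have hN : N = m * υ - 1 / 2 := by rw [hNdef, hMm]
    rw [hxdef, div_mul_eq_mul_div (4 * (υ - 1)) (1.3502 * υ ^ 2) N, le_div_iff₀ (by positivity), hN]
    have hmυ : 0 ≤ m * υ := mul_nonneg hm0 hυ0.le
    nlinarith [mul_le_mul_of_nonneg_right hυ.1 hmυ, mul_le_mul_of_nonneg_right hυm hυ0.le, hυ.1]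
  have hρN' : ρ ^ N ≤ exp (-(27 / 16) * m) := by
    calc ρ ^ N ≤ exp (-x * N) := hexpN ▸ hρN
      _ ≤ exp (-(27 / 16) * m) := exp_le_exp.mpr (by linarith)
  -- `10(υ−2) ≤ e^{m}`
  have hem : 10 * (υ - 2) ≤ exp m := by linarith [add_one_le_exp m]
  have hsplit : exp (-(27 / 16) * m) * exp m = exp (-(11 / 16) * m) := by
    rw [← Real.exp_add]; ring_nf
  have hυ2' : 0 ≤ υ - 2 := by linarith [hυ.1]
  have hfin : 50 * ρ ^ N * (υ - 2) ≤ 5 * exp (-(11 / 16) * m) := by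
    calc 50 * ρ ^ N * (υ - 2) ≤ 50 * exp (-(27 / 16) * m) * (υ - 2) := by gcongr
      _ = 5 * exp (-(27 / 16) * m) * (10 * (υ - 2)) := by ring
      _ ≤ 5 * exp (-(27 / 16) * m) * exp m := by gcongr
      _ = 5 * exp (-(11 / 16) * m) := by rw [mul_assoc, hsplit]
  have hS0 : 0 ≤ exp (9 * υ) * υ ^ (2 * M) * q ^ N := by positivity
  calc 50 * exp (9 * υ) * υ ^ (2 * M) * q ^ N * ρ ^ N * (υ - 2)
      = (exp (9 * υ) * υ ^ (2 * M) * q ^ N) * (50 * ρ ^ N * (υ - 2)) := by ring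
    _ ≤ (exp (9 * υ) * υ ^ (2 * M) * q ^ N) * (5 * exp (-(11 / 16) * m)) := mul_le_mul_of_nonneg_left hfin hS0
    _ = _ := by ring

/-- `A^{M+1} ≤ 0.3502^M·υ^{2M}·(0.3502υ²)` for `0 ≤ A ≤ 0.3502υ²`. -/
theorem pow_succ_le_of_le_sq {M : ℕ} {υ A : ℝ} (hA0 : 0 ≤ A) (hA : A ≤ 0.3502 * υ ^ 2) :
    A ^ (M + 1) ≤ 0.3502 ^ M * υ ^ (2 * M) * (0.3502 * υ ^ 2) := by
  have hAM : A ^ (M + 1) ≤ (0.3502 * υ ^ 2) ^ (M + 1) := pow_le_pow_left₀ hA0 hA _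
  have h1 : ((0.3502 : ℝ) * υ ^ 2) ^ (M + 1) = 0.3502 ^ M * υ ^ (2 * M) * (0.3502 * υ ^ 2) := by
    rw [pow_succ, mul_pow, pow_mul]
  exact h1 ▸ hAM

/-- **T₃** (region R2, segment): `0.225A^{M+1}(2υ/5)^{−2}(υ−2) ≤ 5·e^{9υ}υ^{2M}0.6023^M`. -/
theorem junk_T3_le (M : ℕ) {υ A : ℝ} (hυ : (189 / 20 : ℝ) ≤ υ) (hA0 : 0 ≤ A) (hA : A ≤ 0.3502 * υ ^ 2) :
    0.225 * A ^ (M + 1) * (2 / 5 * υ)⁻¹ ^ 2 * (υ - 2) ≤ 5 * (exp (9 * υ) * υ ^ (2 * M) * 0.6023 ^ M) := by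
  have hυ0 : 0 < υ := by linarith
  have hAM := pow_succ_le_of_le_sq (M := M) hA0 hA
  have hinv : (2 / 5 * υ)⁻¹ ^ 2 = 25 / (4 * υ ^ 2) := by field_simp; ring
  have h2 : (0.3502 : ℝ) ^ M ≤ 0.6023 ^ M := pow_le_pow_left₀ (by norm_num) (by norm_num) M
  have h3 : υ - 2 ≤ exp (9 * υ) := sub_two_le_exp_nine hυ0.le
  have hυ2' : 0 ≤ υ - 2 := by linarith
  rw [hinv]
  calc 0.225 * A ^ (M + 1) * (25 / (4 * υ ^ 2)) * (υ - 2)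
      ≤ 0.225 * (0.3502 ^ M * υ ^ (2 * M) * (0.3502 * υ ^ 2)) * (25 / (4 * υ ^ 2)) * (υ - 2) := by gcongr
    _ = 0.225 * 25 / 4 * 0.3502 * ((0.3502 ^ M * (υ - 2)) * υ ^ (2 * M)) := by field_simp
    _ ≤ 0.225 * 25 / 4 * 0.3502 * ((0.6023 ^ M * exp (9 * υ)) * υ ^ (2 * M)) := by gcongr
    _ ≤ 5 * (exp (9 * υ) * υ ^ (2 * M) * 0.6023 ^ M) := by
        have hX : 0 ≤ 0.6023 ^ M * exp (9 * υ) * υ ^ (2 * M) := by positivity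
        nlinarith [hX]

/-- `A^{3/4} ≤ 1 + A` for `A ≥ 0`. -/
theorem rpow_three_quarters_le {A : ℝ} (hA0 : 0 ≤ A) : A ^ (3 / 4 : ℝ) ≤ 1 + A := by
  rcases le_or_gt A 1 with h | h
  · have := rpow_le_one hA0 h (by norm_num : (0 : ℝ) ≤ 3 / 4); linarith
  · have := rpow_le_rpow_of_exponent_le h.le (show (3 / 4 : ℝ) ≤ 1 by norm_num)
    rw [rpow_one] at this; linarith

/-- **T₄** (region R2, endpoint): `0.71A^M A^{3/4}(2υ/5)^{−1}·4√(υ−2) ≤ 5·e^{9υ}υ^{2M}0.6023^M`. -/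
theorem junk_T4_le (M : ℕ) {υ A : ℝ} (hυ : (189 / 20 : ℝ) ≤ υ) (hA0 : 0 ≤ A) (hA : A ≤ 0.3502 * υ ^ 2) :
    0.71 * (A ^ M * A ^ (3 / 4 : ℝ)) * (2 / 5 * υ)⁻¹ * (4 * Real.sqrt (υ - 2)) ≤
      5 * (exp (9 * υ) * υ ^ (2 * M) * 0.6023 ^ M) := by
  have hυ0 : 0 < υ := by linarith
  have h34 : A ^ (3 / 4 : ℝ) ≤ 1 + 0.3502 * υ ^ 2 := (rpow_three_quarters_le hA0).trans (by linarith)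
  have hAM : A ^ M ≤ (0.3502 * υ ^ 2) ^ M := pow_le_pow_left₀ hA0 hA _
  rw [mul_pow, ← pow_mul] at hAM
  have hsqrt : Real.sqrt (υ - 2) ≤ υ - 2 := by
    rw [Real.sqrt_le_left (by linarith)]; nlinarith
  have hinv : (2 / 5 * υ)⁻¹ = 5 / (2 * υ) := by
    rw [mul_comm]; field_simp
  have hexp : 40 * (1 + 0.3502 * υ ^ 2) ≤ exp (9 * υ) := by
    have h := quadratic_le_exp_of_nonneg (show (0 : ℝ) ≤ 9 * υ by linarith)
    nlinarith
  have h2 : (0.3502 : ℝ) ^ M ≤ 0.6023 ^ M := pow_le_pow_left₀ (by norm_num) (by norm_num) M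
  have h34' : 0 ≤ A ^ (3 / 4 : ℝ) := by positivity
  have hs0 : 0 ≤ Real.sqrt (υ - 2) := Real.sqrt_nonneg _
  rw [hinv]
  calc 0.71 * (A ^ M * A ^ (3 / 4 : ℝ)) * (5 / (2 * υ)) * (4 * Real.sqrt (υ - 2))
      = 7.1 * ((A ^ M * A ^ (3 / 4 : ℝ)) * Real.sqrt (υ - 2)) / υ := by field_simp; ring
    _ ≤ 7.1 * ((0.3502 ^ M * υ ^ (2 * M) * (1 + 0.3502 * υ ^ 2)) * (υ - 2)) / υ := by
        gcongr
    _ ≤ 7.1 * (0.3502 ^ M * υ ^ (2 * M) * (1 + 0.3502 * υ ^ 2)) := by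
        rw [div_le_iff₀ hυ0]
        have hX : 0 ≤ 7.1 * (0.3502 ^ M * υ ^ (2 * M) * (1 + 0.3502 * υ ^ 2)) := by positivity
        nlinarith [hX]
    _ ≤ 5 * (exp (9 * υ) * υ ^ (2 * M) * 0.6023 ^ M) := by
        have hY : (0.3502 : ℝ) ^ M * (40 * (1 + 0.3502 * υ ^ 2)) ≤ 0.6023 ^ M * exp (9 * υ) :=
          mul_le_mul h2 hexp (by positivity) (by positivity)
        have hP : 0 ≤ υ ^ (2 * M) := by positivity
        have hZ := mul_le_mul_of_nonneg_left hY hP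
        have hW : 0 ≤ υ ^ (2 * M) * (0.6023 ^ M * exp (9 * υ)) := by positivity
        nlinarith [hZ, hW]

/-- **T₅** (region R3, bulk): `(0.5635^{M+1}/2)(50+e^{18})·S·e² ≤ 5·S·e^{−(11/16)(M/υ)}` for `M ≥ 60`
(`0.5635 ≤ 0.61·0.927`, `0.61^{60}·0.5635·(50 + 2.72^{18})·2.72²/2 ≤ 5`). -/
theorem junk_T5_le {M : ℕ} (hM : 60 ≤ M) {υ : ℝ} (hυ : (189 / 20 : ℝ) ≤ υ) {S : ℝ} (hS : 0 ≤ S) :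
    0.5635 ^ (M + 1) / 2 * (50 + exp 18) * S * exp 2 ≤ 5 * S * exp (-(11 / 16) * ((M : ℝ) / υ)) := by
  have hE := exp_scale_lower M hυ
  have he1 : exp 1 ≤ 2.72 := (lt_trans exp_one_lt_d9 (by norm_num)).le
  have he18 : exp 18 ≤ 2.72 ^ 18 := by
    rw [show (18 : ℝ) = ((18 : ℕ) : ℝ) * 1 by norm_num, Real.exp_nat_mul]
    exact pow_le_pow_left₀ (exp_pos 1).le he1 18
  have he2 : exp 2 ≤ 2.72 ^ 2 := by
    rw [show (2 : ℝ) = ((2 : ℕ) : ℝ) * 1 by norm_num, Real.exp_nat_mul]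
    exact pow_le_pow_left₀ (exp_pos 1).le he1 2
  have hc : (0.5635 : ℝ) ^ M ≤ 0.61 ^ M * 0.927 ^ M := by
    rw [← mul_pow]; exact pow_le_pow_left₀ (by norm_num) (by norm_num) M
  have h60 : (0.61 : ℝ) ^ M ≤ 0.61 ^ 60 := pow_le_pow_of_le_one (by norm_num) (by norm_num) hM
  have hcM : (0.5635 : ℝ) ^ M ≤ 0.61 ^ 60 * 0.927 ^ M :=
    hc.trans (mul_le_mul_of_nonneg_right h60 (pow_nonneg (by norm_num) M))
  have hnum : (0.5635 : ℝ) * 0.61 ^ 60 * (50 + 2.72 ^ 18) * 2.72 ^ 2 / 2 ≤ 5 := by norm_num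
  have h927 : (0 : ℝ) ≤ 0.927 ^ M := pow_nonneg (by norm_num) M
  calc 0.5635 ^ (M + 1) / 2 * (50 + exp 18) * S * exp 2
      = S * (0.5635 * 0.5635 ^ M * (50 + exp 18) * exp 2 / 2) := by rw [pow_succ]; ring
    _ ≤ S * (0.5635 * (0.61 ^ 60 * 0.927 ^ M) * (50 + 2.72 ^ 18) * 2.72 ^ 2 / 2) := by
        apply mul_le_mul_of_nonneg_left _ hS
        gcongr
    _ = S * 0.927 ^ M * (0.5635 * 0.61 ^ 60 * (50 + 2.72 ^ 18) * 2.72 ^ 2 / 2) := by ring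
    _ ≤ S * 0.927 ^ M * 5 := mul_le_mul_of_nonneg_left hnum (mul_nonneg hS h927)
    _ = 5 * S * 0.927 ^ M := by ring
    _ ≤ 5 * S * exp (-(11 / 16) * ((M : ℝ) / υ)) := mul_le_mul_of_nonneg_left hE (by positivity)

/-- **T₆** (region R3, endpoint): `1.65A^{M+1}(υ−2)^{−1} ≤ 5·e^{9υ}υ^{2M}0.6023^M`. -/
theorem junk_T6_le (M : ℕ) {υ A : ℝ} (hυ : (189 / 20 : ℝ) ≤ υ) (hA0 : 0 ≤ A) (hA : A ≤ 0.3502 * υ ^ 2) :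
    1.65 * A ^ (M + 1) * (υ - 2)⁻¹ ≤ 5 * (exp (9 * υ) * υ ^ (2 * M) * 0.6023 ^ M) := by
  have hυ0 : 0 < υ := by linarith
  have hc : 0 < υ - 2 := by linarith
  have hAM := pow_succ_le_of_le_sq (M := M) hA0 hA
  have h2 : (0.3502 : ℝ) ^ M ≤ 0.6023 ^ M := pow_le_pow_left₀ (by norm_num) (by norm_num) M
  -- `υ²/(υ−2) ≤ e^{9υ}`
  have hexp : υ ^ 2 ≤ (υ - 2) * exp (9 * υ) := by
    have h := quadratic_le_exp_of_nonneg (show (0 : ℝ) ≤ 9 * υ by linarith)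
    nlinarith
  have hinv0 : 0 ≤ (υ - 2)⁻¹ := inv_nonneg.mpr hc.le
  calc 1.65 * A ^ (M + 1) * (υ - 2)⁻¹
      ≤ 1.65 * (0.3502 ^ M * υ ^ (2 * M) * (0.3502 * υ ^ 2)) * (υ - 2)⁻¹ := by gcongr
    _ = 1.65 * 0.3502 * (0.3502 ^ M * υ ^ (2 * M)) * (υ ^ 2 * (υ - 2)⁻¹) := by ring
    _ ≤ 1.65 * 0.3502 * (0.6023 ^ M * υ ^ (2 * M)) * exp (9 * υ) := by
        have hq : υ ^ 2 * (υ - 2)⁻¹ ≤ exp (9 * υ) := by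
          rw [← div_eq_mul_inv, div_le_iff₀ hc]; linarith
        gcongr
    _ ≤ 5 * (exp (9 * υ) * υ ^ (2 * M) * 0.6023 ^ M) := by
        have hX : 0 ≤ 0.6023 ^ M * υ ^ (2 * M) * exp (9 * υ) := by positivity
        nlinarith [hX]

/-! ## 3. The budget -/

/-- **The budget.** At the far mode, for `M ≥ 2·10¹⁸`, `q ≥ 0.6498` and `0 ≤ A ≤ 0.3502υ²`, the sum of the region bounds of
parts B/B2/C (with `‖1+z̃‖ ↦ q`, `‖a‖ ↦ A`) is at most `(π²/2)e^{9υ}υ^{2M}q^{M−½}·e^{−9Λ/8}√(2π/Λ)` (`= farEnv`, `farEnv_eq`). -/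
theorem junk_budget {M : ℕ} (hM : 2 * 10 ^ 18 ≤ M) {υ : ℝ}
    (hυ : (189 / 20 : ℝ) ≤ υ ∧ 4 * π * exp (4 * υ) * υ = 2 * (M : ℝ) + 9 * υ) {q A : ℝ} (hq : 0.6498 ≤ q)
    (hA0 : 0 ≤ A) (hA : A ≤ 0.3502 * υ ^ 2) :
    (0.45 * (0.5102 * υ ^ 2) ^ M +
            50 * exp (9 * υ) * υ ^ (2 * M) * q ^ ((M : ℝ) - 1 / 2) *
              (((υ - 2) ^ 2 / υ ^ 2 + 0.3502) / 1.3502) ^ ((M : ℝ) - 1 / 2) +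
            0.225 * A ^ (M + 1) * (2 / 5 * υ)⁻¹ ^ 2) * (υ - 2) +
          0.71 * (A ^ M * A ^ (3 / 4 : ℝ)) * (2 / 5 * υ)⁻¹ * (4 * Real.sqrt (υ - 2)) +
        (0.5635 ^ (M + 1) / 2 * (50 + exp 18) * (exp (9 * υ) * υ ^ (2 * M) * q ^ ((M : ℝ) - 1 / 2)) * exp 2 +
          1.65 * A ^ (M + 1) * (υ - 2)⁻¹) ≤
      π ^ 2 / 2 * exp (9 * υ) * υ ^ (2 * M) * q ^ ((M : ℝ) - 1 / 2) *
        (exp (-(9 / 8) * farLam υ) * Real.sqrt (2 * π / farLam υ)) := by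
  have hM1 : 1 ≤ M := le_trans (by norm_num) hM
  have hM60 : 60 ≤ M := le_trans (by norm_num) hM
  have hq0 : 0 ≤ q := le_trans (by norm_num) hq
  have hS0 : 0 ≤ exp (9 * υ) * υ ^ (2 * M) * q ^ ((M : ℝ) - 1 / 2) := by
    have hυ0 : 0 < υ := by linarith [hυ.1]
    positivity
  have t1 := junk_T1_le M hυ.1
  have t2 := junk_T2_le M hM1 hυ hq0
  have t3 := junk_T3_le M hυ.1 hA0 hA
  have t4 := junk_T4_le M hυ.1 hA0 hA
  have t5 := junk_T5_le hM60 hυ.1 hS0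
  have t6 := junk_T6_le M hυ.1 hA0 hA
  have hs := junk_scale_lower hM1 hυ.1 hq
  have henv := mul_le_mul_of_nonneg_left (farEnv_factor_lower M hυ) hS0
  nlinarith [t1, t2, t3, t4, t5, t6, hs, henv]

/-! ## 4. The size of `a = farA M s` -/

/-- `‖farA M s‖ ≤ 0.3502υ²` for `‖s‖ ≤ (7/20)M`, `M ≥ 2·10¹⁸`, at the far mode (`|c_M − υ²| ≤ υ²/4000`). -/
theorem norm_farA_le {M : ℕ} (hM : 2 * 10 ^ 18 ≤ M) {υ : ℝ}
    (hυ : (189 / 20 : ℝ) ≤ υ ∧ 4 * π * exp (4 * υ) * υ = 2 * (M : ℝ) + 9 * υ) {s : ℂ}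
    (hs : ‖s‖ ≤ (7 / 20 : ℝ) * M) : ‖farA M s‖ ≤ 0.3502 * υ ^ 2 := by
  have hc := abs_cM_sub_sq_le_4000 M hM hυ
  have hMr : (2 * 10 ^ 18 : ℝ) ≤ M := by exact_mod_cast hM
  have hN : (0 : ℝ) < (M : ℝ) - 1 / 2 := by linarith
  have hcM : |cM M| ≤ (1 + 1 / 4000) * υ ^ 2 := by
    have h := abs_sub_abs_le_abs_sub (cM M) (υ ^ 2)
    rw [abs_of_nonneg (sq_nonneg υ)] at h
    linarith
  unfold farA
  rw [norm_div, norm_mul, Complex.norm_real, Complex.norm_real, Real.norm_eq_abs, Real.norm_of_nonneg hN.le,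
    div_le_iff₀ hN]
  calc ‖s‖ * |cM M| ≤ (7 / 20 : ℝ) * M * ((1 + 1 / 4000) * υ ^ 2) := mul_le_mul hs hcM (abs_nonneg _) (by positivity)
    _ ≤ 0.3502 * υ ^ 2 * ((M : ℝ) - 1 / 2) := by
        nlinarith [mul_nonneg (sq_nonneg υ) (show (0 : ℝ) ≤ 0.0001125 * M - 0.1751 by linarith)]

end Summit.RiemannHypothesis.RiemannHypothesis.Theorems.JensenPolynomials.FarGumbel

end
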